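import Summits.HubbardSuperconductivity.HubbardLadder.NeelSignUniformShellSixAfterC15
import Summits.HubbardSuperconductivity.HubbardLadder.NeelSignC06C4
import HarnessLib

/-!
# The typed conjecture (S) through distance 6 after the cells `(1,5)` and `(0,6)`, BY NAME: `NeelSignUniformUpTo 6 ↔ NeelSignCell 3 3` (HubbardLadder R2, lineage B)

HONEST FRAMING: ladder R1–R4 with certified numbers; no claim on H/H₀.  Reference model only (spin-½ Heisenberg antiferromagnet on
even tori); BOOKKEEPING over landed kernel rows in the style of `NeelSignUniformShellSix` — it proves no new inequality and asserts
nothing about Néel order or the Hubbard model.  Inputs: `neelSignUniformUpTo_six_iff_cells_06_33` (`NeelSignUniformShellSixAfterC15`: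
shell 6 after `(1,5)` = (0,6) ∧ (3,3)) and `neelSignCell_0_6` (`NeelSignC06C4`, certificate `C4`).  Pen: r2-eng-2 g15 (staged with the `(0,6)` road;
files only after `NeelSignUniformShellSixAfterC15` and `NeelSignC06C4` are BUILT).  What it names: after both cluster-cut cells the ONLY open cell of (S)
through distance 6 is the diagonal `(3,3)` (no L-uniform certificate of record: LP value 0 on every arm tried, N-141 / N-143).
[cite: KLS1988JSP, p. 1021] [cite: DLS1978, Theorem 4.2]
-/

noncomputable section

namespace Summit.HubbardSuperconductivity.HubbardLadder

open Literature.MathematicalPhysics.QuantumLattice Summit.HubbardSuperconductivity.Conjectures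

/-! ### Shell 6 of the typed conjecture (S) after `(1,5)` and `(0,6)`, BY NAME -/

/-- **After the cells `(1,5)` and `(0,6)`, shell 6 is the one cell `(3,3)`**: `NeelSignUniformUpTo 6 ↔ NeelSignCell 3 3`
(the tree's `neelSignUniformUpTo_six_iff` with `neelSignCell_1_5` and `neelSignCell_0_6` substituted).  BOOKKEEPING ONLY over landed kernel rows —
no new inequality.  HONEST FRAMING: ladder R1–R4 with certified numbers; no claim on H/H₀. [cite: KLS1988JSP, p. 1021] -/
theorem neelSignUniformUpTo_six_iff_cell_33 : NeelSignUniformUpTo 6 ↔ NeelSignCell 3 3 := by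
  rw [neelSignUniformUpTo_six_iff_cells_06_33]
  exact ⟨fun h => h.2, fun h => ⟨neelSignCell_0_6, h⟩⟩

/-- The distance-6 truncation of (S) from its one remaining open cell (converse direction, for assembly).
HONEST FRAMING: ladder R1–R4 with certified numbers; no claim on H/H₀. [cite: KLS1988JSP, p. 1021] -/
theorem neelSignUniformUpTo_six_of_cell_33 (h33 : NeelSignCell 3 3) : NeelSignUniformUpTo 6 :=
  neelSignUniformUpTo_six_iff_cell_33.mpr h33

end Summit.HubbardSuperconductivity.HubbardLadder

end
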